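import Literature.MathematicalPhysics.QuantumFieldTheory.Balaban1983to89.B8Eq131DerivationRec

/-!
# `Balaban1983to89.B8Eq106LocalRec` — [Balaban1985RegularSpaces] proof of Theorem 4, p. 88: «From (64)–(87) of [3] it follows that `u₁` is determined uniquely in terms of
# `U₁` and is given by (106)» — on the CENTRED block tower `Bʲ(y)` under a site `y ∈ Λ_j` the inductive gauge transformation IS [Balaban1985Averaging]'s gauge fixing
# (104)–(106) at top level `j`, FOR THE RECORD's symmetric averaging [Balaban1987RG1] (0.4); the record twin of `B8Eq106Local` §0–§1 (its class-A declarations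
# `under_iff_tower ∕ uLev_eq_glev_local ∕ eq106_local ∕ eq106_of_inAx_restr129`; LEAD PEN dag-n05-e, cell member dag-n05-d)

statement-level skeleton of published theorems with citation tags; proofs where landed; nothing here is a claim about the Yang–Mills mass gap

CITATION HEADER.  [6] = [Balaban1985RegularSpaces] p. 88 (sentence after (1.69)): *«From (64)–(87) of [3] it follows that u₁ is determined uniquely in terms of U₁ and is given by
(106)»*; (1.19) p. 79, (1.29) p. 81, (1.34) p. 82.  [3] = [Balaban1985Averaging] (76)–(77) pp. 29–30, (87) p. 31, (106) p. 33.  [I] = [Balaban1987RG1] (0.3)–(0.4) pp. 252–253.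
Cell `pub-ymgap`, seat dag-n05-d g23, «N05-REC» road item R2 (TOKEN RULE (T1)∕(T2)∕(T5): `avgIter ↦ avgIterZ`, `Under ↦ UnderZ`, `boxVec ↦ offZ`, `fl∕brem ↦` dag-n05-e's
`flZ∕bremZ`, `glev ↦ glevZ`, `uavg ↦ uavgZ`, `InAx ↦ InAxZ`, `Restr129 ↦ Restr129Z`; engine names kept).  §2 of the engine module ((1.72)–(1.74)∕(214) for `u₁` via
`B8Ineq172Concrete`∕`B8Eq1115Concrete`) keys on dag-n05-c's R5 twins and is NOT typed here.  `--kind proof --supports stmt-QuantumFields-20541` (K0⁷; count-neutral).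

WHAT IS PROVED (sorry-free).  §0 `under_iff_tower` (`UnderZ L m y z ↔ tlo L y m ≤ z ≤ thi L y m`, centred tower of `B8Ineq130Rec`, odd `L`), `flZ_eq_fl` (dag-n05-e's `flZ` IS
`B8Ineq130Rec.fl`, `rfl`).  §1 ★★`uLev_eq_glev_local` (LOCAL UNIQUENESS of [3]'s gauge fixing level by level, under one site), ★`eq106_local`, ★★`eq106_of_inAxZ_restr129Z`.
HONEST SCOPE.  Pure algebra (no smallness, any background, odd `L`); nothing of [3]∕[6]∕[I] beyond these lines asserted; `HThm4Rec` UNDISCHARGED; N05 ∕ N07 NOT discharged;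
counts unmoved; one finite 𝕋⁴ programme at fixed ε — nothing continuum ∕ ℝ⁴ ∕ OS ∕ mass gap ∕ Clay.  No `def`, no `instance`, no `notation`, no `sorry`.
-/

noncomputable section

open NormedSpace Finset

namespace Literature.MathematicalPhysics.QuantumFieldTheory.Balaban1983to89.B8Eq106LocalRec

open B7Prop1Explicit B7Prop2Explicit B7AvgGaugeCovariance BlockAveragingZd B8Lemma1NonAbelianRecLoops B8Ineq130Rec
open B7Eq92Concrete (mgauge tHol Rc Rc_inv_apply)
open B7Eq99Concrete (R0fun R0fun_apply)
open B7Eq84Concrete (eq72_iff_eq76)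
open B7SectCDGaugeAveragesRec (flZ bremZ flZ_decomp tildIterZ wrecZ uavgZ glevZ)
open B7Eq92ConcreteRec (tildIterZ_mgauge)
open B7Eq84ConcreteRec (glevZ_top glevZ_of_lt)
open B8Ineq130 (inBox_of_le)
open B8Eq119TwistedAxialRec (UnderZ underZ_zero_iff InAxZ Restr129Z)
open B8Eq178AveragesRec (rbarZ_restr_iff_uavgZ)
open B8Eq131DerivationRec (eq87_local ax119_iff_ax67)

-- `Site` alone could resolve to the torus sites of `Setup.lean`; re-export the `ℤ^d` sites of `B7Prop1Explicit`.
export B7Prop1Explicit (Site)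

variable {d : ℕ}

/-! ## §0 `UnderZ` is the centred tower box -/

/-- **«`z ∈ Bᵐ(y)`» in the two record spellings**: `B8Eq119TwistedAxialRec.UnderZ L m y z` ⟺ `tlo L y m ≤ z ≤ thi L y m` (`B8Ineq130Rec`'s CENTRED tower with `lo = hi = y`),
odd `L`. [cite: Balaban1985RegularSpaces, p.79 ("x₀ ∈ Bʲ(x_j)"); Balaban1987RG1, (0.3) p.252] -/
theorem under_iff_tower {L : ℕ} (hL : Odd L) (m : ℕ) (y z : Site d) : UnderZ L m y z ↔ tlo L y m ≤ z ∧ z ≤ thi L y m := by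
  constructor
  · intro h
    exact ⟨fun i => by rw [tlo_apply hL]; linarith [(h i).1], fun i => by rw [thi_apply hL]; linarith [(h i).2]⟩
  · rintro ⟨h1, h2⟩ i
    have h1i := h1 i
    have h2i := h2 i
    rw [tlo_apply hL] at h1i
    rw [thi_apply hL] at h2i
    exact ⟨by linarith, by linarith⟩

/-- dag-n05-e's one-step centred floor `flZ` IS `B8Ineq130Rec.fl` (both `⌊(x + s𝟙)∕L⌋`). [cite: Balaban1987RG1, (0.3) p.252 (bookkeeping)] -/
theorem flZ_eq_fl (L : ℕ) (x : Site d) : flZ L x = fl L x := rfl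

/-! ## §1 «`u₁` is determined uniquely in terms of `U₁` and is given by (106)» on the centred tower under one site -/

section Identification

variable {𝔸 : Type*} [NormedRing 𝔸] [NormedAlgebra ℂ 𝔸] [CompleteSpace 𝔸]

/-- **LOCAL UNIQUENESS OF THE GAUGE FIXING OF [3] = B8 p. 88 «`u₁` … is given by (106)», LEVEL BY LEVEL, RECORD AVERAGING.**  Let `U′ = U₁^{u}` satisfy the block axial
gauge conditions (67) = (1.19) on every CENTRED block of the tower under the level-`j` site `y` (levels `n < j`, centres `Lz`, `z ∈ B^{j−n−1}(y)`) and let (81) = (1.29) hold at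
`y`: `uavgZ L U₀ u j y = 1`.  Then for every `m ≤ j` and every level-`m` site `x ∈ B^{j−m}(y)`, `u_m(x) = glevZ … j m x` (dag-n05-e's level functions): print's downward
induction (77) — (87) at `y` (`B8Eq131DerivationRec.eq87_local`), then (76) on each centred block pins the block values from the centre value (`eq72_iff_eq76`).  Pure
algebra; `L = 2s+1`. [cite: Balaban1985RegularSpaces, p.88 (sentence after (1.69)), (1.19) p.79, (1.29) p.81; Balaban1985Averaging, (76)–(77) p.29–30, (87) p.31, (106) p.33; Balaban1987RG1, (0.3)–(0.4) pp.252–253] -/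
theorem uLev_eq_glev_local {L s : ℕ} (hLs : L = 2 * s + 1) (hL : 1 ≤ L) (U₀ U₁ : Site d → Fin d → 𝔸ˣ) (u : Site d → 𝔸ˣ) (j : ℕ) (y : Site d)
    (hax : ∀ n, n < j → ∀ z : Site d, UnderZ L (j - (n + 1)) y z → ∀ r : Fin d → Fin L,
      tHol (avgIterZ L U₀ n) (tildIterZ L U₀ (mgauge U₀ u U₁) n) ((L : ℤ) • z) (treeWord (offZ L r)) = 1)
    (h129 : uavgZ L U₀ u j y = 1) :
    ∀ (n m : ℕ), n + m = j → ∀ x : Site d, UnderZ L n y x → uLev L u m x = glevZ L hL U₀ U₁ j m x := by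
  have hLo : Odd L := ⟨s, hLs⟩
  intro n
  induction n with
  | zero =>
    intro m hm x hx
    have hmj : m = j := by omega
    subst hmj
    rw [(underZ_zero_iff L y x).1 hx, glevZ_top]
    exact eq87_local hLs U₀ U₁ u m y hax h129
  | succ n ih =>
    intro m hm x hx
    have hmj : m < j := by omega
    obtain ⟨hx1, hx2⟩ := (under_iff_tower hLo (n + 1) y x).1 hx
    obtain ⟨hf, hf'⟩ := fl_mem hLs hx1 hx2
    have hz : UnderZ L n y (flZ L x) := (under_iff_tower hLo n y (flZ L x)).2 ⟨hf, hf'⟩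
    -- (76) on the centred block of `x_{m+1} = flZ x` at level `m`, from (67) there (`j − (m+1) = n`)
    have h67 := hax m hmj (flZ L x) (by rw [show j - (m + 1) = n by omega]; exact hz) (bremZ L hL x)
    rw [tildIterZ_mgauge] at h67
    have h76 := (eq72_iff_eq76 (avgIterZ L U₀ m) (tildIterZ L U₀ U₁ m) (uLev L u m) ((L : ℤ) • flZ L x)
      ((L : ℤ) • flZ L x + offZ L (bremZ L hL x))).1
    rw [add_sub_cancel_left] at h76
    have h76' := h76 h67
    rw [R0fun_apply, add_sub_cancel_left, flZ_decomp hL x, uLev_smul, ih (m + 1) (by omega) (flZ L x) hz] at h76'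
    rw [glevZ_of_lt L hL U₀ U₁ hmj, ← h76']
    exact ((Rc_inv_apply _ _).1).symm

/-- **(106) on the fine centred block, record averaging**: under the hypotheses of `uLev_eq_glev_local`, `u(x) = glevZ … j 0 x` for every fine site `x ∈ Bʲ(y)`.
[cite: Balaban1985RegularSpaces, p.88 (sentence after (1.69)); Balaban1985Averaging, (106) p.33] -/
theorem eq106_local {L s : ℕ} (hLs : L = 2 * s + 1) (hL : 1 ≤ L) (U₀ U₁ : Site d → Fin d → 𝔸ˣ) (u : Site d → 𝔸ˣ) (j : ℕ) (y : Site d)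
    (hax : ∀ n, n < j → ∀ z : Site d, UnderZ L (j - (n + 1)) y z → ∀ r : Fin d → Fin L,
      tHol (avgIterZ L U₀ n) (tildIterZ L U₀ (mgauge U₀ u U₁) n) ((L : ℤ) • z) (treeWord (offZ L r)) = 1)
    (h129 : uavgZ L U₀ u j y = 1) (x : Site d) (hx : UnderZ L j y x) : u x = glevZ L hL U₀ U₁ j 0 x := by
  have h := uLev_eq_glev_local hLs hL U₀ U₁ u j y hax h129 j 0 (by omega) x hx
  rwa [uLev_zero] at h

/-- **… for the TYPED RECORD classes**: if `U′U₀ ∈ Ax_k(𝔅_k, U₀)` (`B8Eq119TwistedAxialRec.InAxZ`) with `U′ = U₁^{u}`, and `u` satisfies (1.29) (`Restr129Z`), then for every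
`j ≤ k`, every `y ∈ Λ_j` and every fine site `x ∈ Bʲ(y)` (centred): `u(x) = glevZ … j 0 x` — the gauge transformation on `Bʲ(Λ_j)` «in terms of `U₁`».
[cite: Balaban1985RegularSpaces, p.88 (sentence after (1.69)), (1.19) p.79, (1.29) p.81, (1.34) p.82; Balaban1985Averaging, (106) p.33; Balaban1987RG1, (0.4) p.253] -/
theorem eq106_of_inAxZ_restr129Z {L s : ℕ} (hLs : L = 2 * s + 1) (hL : 1 ≤ L) (k : ℕ) (Λ : ℕ → Set (Site d)) (U₀ U₁ : Site d → Fin d → 𝔸ˣ)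
    (u : Site d → 𝔸ˣ) (hAx : InAxZ L k Λ U₀ (mgauge U₀ u U₁ * U₀)) (h129 : Restr129Z L k Λ U₀ u)
    {j : ℕ} (hjk : j ≤ k) {y : Site d} (hy : y ∈ Λ j) (x : Site d) (hx : UnderZ L j y x) :
    u x = glevZ L hL U₀ U₁ j 0 x := by
  unfold Restr129Z at h129
  rw [rbarZ_restr_iff_uavgZ] at h129
  refine eq106_local hLs hL U₀ U₁ u j y (fun n hn z hz r => ?_) (h129 j hjk y hy) x hx
  exact (ax119_iff_ax67 L U₀ (mgauge U₀ u U₁) n z r).1 (hAx j (by omega) hjk y hy n hn z hz r)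

end Identification

end Literature.MathematicalPhysics.QuantumFieldTheory.Balaban1983to89.B8Eq106LocalRec

/-! ## Axiom audit (gate whitelist: `propext`, `Classical.choice`, `Quot.sound`) -/
#print axioms Literature.MathematicalPhysics.QuantumFieldTheory.Balaban1983to89.B8Eq106LocalRec.eq106_of_inAxZ_restr129Z
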